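import Mathlib
import HarnessLib.Audit
import Summits.PneNP.PneNP.Theorems.PstarChordReads

/-!
# The chord involution on the OTHER private, reader symmetry, and sums of G-constraints (ROUND-24, O1; `TerminalPeelable`)

FRONTIER range-avoidance ladder, rung F-N3, ROUND 24 (cell `pnp-ideate`, prover-2 memo `g19/O1-CHORD-READ.md` §2–§3; referee SCORE 223,
Part 1 note "the q-side mirror … is not yet in the tree"; typed target `PstarCoreBoundTargets.TerminalPeelable` (p646951); restricted-model proof
complexity — nothing here bears on `P` versus `NP`).

`PstarChordReads` flips the private `p = vars c 2` of a chord `c` at solutions with `x_q = 0` (`q = vars c 3`).  The chord-read lemma uses BOTH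
orientations ("by the repair lemma WLOG `p` is read — swap the names `p, q`"); the instance has fixed slots, so the swap is a lemma, not a renaming:

* `solves_update_of_chord₃` — flipping `q` at a solution of the core with `x_p = 0` gives a solution of the core;
* `gval₂_ne_of_read₁₃` / `gval₁_ne_of_read₂₃` / `gval_iff_of_read_both₃` — the INVOLUTION LEMMA for `q` read linearly (directions `(1,0)`, `(0,1)`,
  `(1,1)`), concluding at every solution of the core with `x_p = 0`;
* `terminal_swap` — `Terminal` is symmetric in the two constraints;
* `gval_pair` — the two-variable read `{a, b}` evaluates to `x_a ⊕ x_b`;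
* `solves_set_privates` — setting the two privates of a chord to `(π, κ)` at a solution of `J₀ ∖ c` with `x_a ⊕ x_b ⊕ πκ = y_c` solves `J₀`;
* `exists_ne_of_xorClosed` — an XOR-closed set containing `c` contains another output.

All assumption-free (no Assumption A, no genericity); inputs of `PstarChordReadLemma` (the sum of two G-constraints, needed for direction `(1,1)`,
is `PstarGSystemFreeVar.gval_symmDiff`).
-/

set_option linter.dupNamespace false -- `Summit.PneNP.PneNP.…`: summit = sub-problem name (D-0017 single-conjunct layout)

open Finset Literature.Computability.Complexity
open Summit.PneNP.PneNP.Theorems.PstarFibrePolys (bit bit_injective bit_xor bit_and)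
open Summit.PneNP.PneNP.Theorems.PstarSALevel (varSet bdry)
open Summit.PneNP.PneNP.Theorems.PstarSAClosure (degIn mem_bdry_iff)
open Summit.PneNP.PneNP.Theorems.PstarGapPeeling (eval_update_of_not_mem not_mem_varSet_of_private)
open Summit.PneNP.PneNP.Theorems.PstarCentreFree (vars_mem_varSet)
open Summit.PneNP.PneNP.Theorems.PstarGapOneAll (gval)
open Summit.PneNP.PneNP.Theorems.PstarGConstraint (bit_gval)
open Summit.PneNP.PneNP.Theorems.PstarCoreBound (XorClosed)
open Summit.PneNP.PneNP.Theorems.PstarChordRepair (IsChord)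
open Summit.PneNP.PneNP.Theorems.PstarCoreBoundTargets (Terminal)
open Summit.PneNP.PneNP.Theorems.PstarFreshErase (bit_gval_update_lin bit_eval_e slots_ne)
open Summit.PneNP.PneNP.Theorems.PstarChordReads (eval_update_of_private gval_update_not)

namespace Summit.PneNP.PneNP.Theorems.PstarChordReadsMirror

variable {n m : ℕ}

/-! ## Flipping the other private -/
section Flip

variable {I : LocalMap 4 n m} {J₀ : Finset (Fin m)} {c : Fin m} {y : Fin m → Bool}

/-- With `x_p = 0` the equation of `c` does not see `q`. -/
theorem eval_update_three_of_two (hI : I.IsPure xorAndPred) (x : Fin n → Bool) (hp : x (I.vars c 2) = false) (b : Bool) :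
    I.eval (Function.update x (I.vars c 3) b) c = I.eval x c := by
  have hpp : (I.vars c 2 = I.vars c 2 ∧ I.vars c 3 = I.vars c 3) ∨ (I.vars c 2 = I.vars c 3 ∧ I.vars c 3 = I.vars c 2) := Or.inl ⟨rfl, rfl⟩
  obtain ⟨-, -, h0q, -, h1q⟩ := slots_ne hI hpp
  have h23 : I.vars c 2 ≠ I.vars c 3 := fun h => absurd (hI.2 c h) (by decide)
  apply bit_injective
  rw [bit_eval_e hI hpp, bit_eval_e hI hpp, Function.update_of_ne h0q, Function.update_of_ne h1q, Function.update_of_ne h23, hp]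
  simp [bit]

/-- **The involution on `q`.**  Flipping the private `q = vars c 3` of a chord at a solution of the core with `x_p = 0` gives a solution of the core. -/
theorem solves_update_of_chord₃ (hI : I.IsPure xorAndPred) (hc : c ∈ J₀) (hch : IsChord I J₀ c) {x : Fin n → Bool}
    (hx : ∀ j ∈ J₀, I.eval x j = y j) (hp : x (I.vars c 2) = false) (b : Bool) :
    ∀ j ∈ J₀, I.eval (Function.update x (I.vars c 3) b) j = y j := by
  intro j hj
  by_cases hjc : j = c
  · subst hjc; rw [eval_update_three_of_two hI x hp b, hx j hj]
  · rw [eval_update_of_private hc hj hjc hch.2 (vars_mem_varSet I c 3) x b, hx j hj]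

end Flip

/-! ## The involution lemma for `q` -/
section Terminal

variable {I : LocalMap 4 n m} {r : ℕ} {y : Fin m → Bool} {J₀ : Finset (Fin m)} {w₁ w₂ : Finset (Fin n) × Finset (Fin m) × Bool} {c : Fin m}

/-- (T3): no solution of the core satisfies both constraints. -/
private theorem not_both (ht : Terminal I r y J₀ w₁ w₂) {x : Fin n → Bool} (hx : ∀ j ∈ J₀, I.eval x j = y j)
    (h₁ : gval I w₁.1 w₁.2.1 x = w₁.2.2) (h₂ : gval I w₂.1 w₂.2.1 x = w₂.2.2) : False :=
  ht.2.2.2.2.2.2.1 ⟨x, hx, h₁, h₂⟩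

/-- **INVOLUTION LEMMA for `q`, direction `(1,0)`.**  If the private `q = vars c 3` of a chord is touched by no monomial, read linearly by `Γ₁` and
not by `Γ₂`, then `Γ₂` FAILS at every solution of the core with `x_p = 0`. -/
theorem gval₂_ne_of_read₁₃ (hI : I.IsPure xorAndPred) (ht : Terminal I r y J₀ w₁ w₂) (hc : c ∈ J₀) (hch : IsChord I J₀ c)
    (hmono : ∀ g ∈ w₁.2.1 ∪ w₂.2.1, I.vars g 2 ≠ I.vars c 3 ∧ I.vars g 3 ≠ I.vars c 3) (hq₁ : I.vars c 3 ∈ w₁.1) (hq₂ : I.vars c 3 ∉ w₂.1)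
    {x : Fin n → Bool} (hx : ∀ j ∈ J₀, I.eval x j = y j) (hp : x (I.vars c 2) = false) : gval I w₂.1 w₂.2.1 x ≠ w₂.2.2 := by
  intro h₂
  have hx' := solves_update_of_chord₃ hI hc hch hx hp (!x (I.vars c 3))
  have h₁' := gval_update_not I w₁.1 x (fun g hg => hmono g (mem_union_left _ hg))
  have h₂' := gval_update_not I w₂.1 x (fun g hg => hmono g (mem_union_right _ hg))
  rw [if_pos hq₁] at h₁'
  rw [if_neg hq₂, h₂] at h₂'
  by_cases h₁ : gval I w₁.1 w₁.2.1 x = w₁.2.2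
  · exact not_both ht hx h₁ h₂
  · refine not_both ht hx' ?_ h₂'
    rw [h₁']
    revert h₁
    cases gval I w₁.1 w₁.2.1 x <;> cases w₁.2.2 <;> decide

/-- **INVOLUTION LEMMA for `q`, direction `(0,1)`** (the mirror image). -/
theorem gval₁_ne_of_read₂₃ (hI : I.IsPure xorAndPred) (ht : Terminal I r y J₀ w₁ w₂) (hc : c ∈ J₀) (hch : IsChord I J₀ c)
    (hmono : ∀ g ∈ w₁.2.1 ∪ w₂.2.1, I.vars g 2 ≠ I.vars c 3 ∧ I.vars g 3 ≠ I.vars c 3) (hq₁ : I.vars c 3 ∉ w₁.1) (hq₂ : I.vars c 3 ∈ w₂.1)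
    {x : Fin n → Bool} (hx : ∀ j ∈ J₀, I.eval x j = y j) (hp : x (I.vars c 2) = false) : gval I w₁.1 w₁.2.1 x ≠ w₁.2.2 := by
  intro h₁
  have hx' := solves_update_of_chord₃ hI hc hch hx hp (!x (I.vars c 3))
  have h₁' := gval_update_not I w₁.1 x (fun g hg => hmono g (mem_union_left _ hg))
  have h₂' := gval_update_not I w₂.1 x (fun g hg => hmono g (mem_union_right _ hg))
  rw [if_neg hq₁, h₁] at h₁'
  rw [if_pos hq₂] at h₂'
  by_cases h₂ : gval I w₂.1 w₂.2.1 x = w₂.2.2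
  · exact not_both ht hx h₁ h₂
  · refine not_both ht hx' h₁' ?_
    rw [h₂']
    revert h₂
    cases gval I w₂.1 w₂.2.1 x <;> cases w₂.2.2 <;> decide

/-- **INVOLUTION LEMMA for `q`, direction `(1,1)`.**  If both constraints read `q` linearly (and no monomial touches it), then at every solution
of the core with `x_p = 0` EXACTLY ONE of `Γ₁, Γ₂` holds. -/
theorem gval_iff_of_read_both₃ (hI : I.IsPure xorAndPred) (ht : Terminal I r y J₀ w₁ w₂) (hc : c ∈ J₀) (hch : IsChord I J₀ c)
    (hmono : ∀ g ∈ w₁.2.1 ∪ w₂.2.1, I.vars g 2 ≠ I.vars c 3 ∧ I.vars g 3 ≠ I.vars c 3) (hq₁ : I.vars c 3 ∈ w₁.1) (hq₂ : I.vars c 3 ∈ w₂.1)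
    {x : Fin n → Bool} (hx : ∀ j ∈ J₀, I.eval x j = y j) (hp : x (I.vars c 2) = false) :
    (gval I w₁.1 w₁.2.1 x = w₁.2.2 ↔ gval I w₂.1 w₂.2.1 x ≠ w₂.2.2) := by
  have hx' := solves_update_of_chord₃ hI hc hch hx hp (!x (I.vars c 3))
  have h₁' := gval_update_not I w₁.1 x (fun g hg => hmono g (mem_union_left _ hg))
  have h₂' := gval_update_not I w₂.1 x (fun g hg => hmono g (mem_union_right _ hg))
  rw [if_pos hq₁] at h₁'
  rw [if_pos hq₂] at h₂'
  have hA := fun (a : gval I w₁.1 w₁.2.1 x = w₁.2.2) (b : gval I w₂.1 w₂.2.1 x = w₂.2.2) => not_both ht hx a b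
  have hB := fun (a : gval I w₁.1 w₁.2.1 (Function.update x (I.vars c 3) (!x (I.vars c 3))) = w₁.2.2)
    (b : gval I w₂.1 w₂.2.1 (Function.update x (I.vars c 3) (!x (I.vars c 3))) = w₂.2.2) => not_both ht hx' a b
  rw [h₁', h₂'] at hB
  revert hA hB
  cases gval I w₁.1 w₁.2.1 x <;> cases w₁.2.2 <;> cases gval I w₂.1 w₂.2.1 x <;> cases w₂.2.2 <;> decide

/-- **`Terminal` is symmetric in the two constraints.** -/
theorem terminal_swap (ht : Terminal I r y J₀ w₁ w₂) : Terminal I r y J₀ w₂ w₁ := by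
  obtain ⟨hne, hX, hJr, hG₁, hG₂, hr, hT3, hM0⟩ := ht
  refine ⟨hne, hX, hJr, hG₂, hG₁, ?_, ?_, ?_⟩
  · rwa [union_right_comm]
  · rintro ⟨z, hz, h₂, h₁⟩
    exact hT3 ⟨z, hz, h₁, h₂⟩
  · intro f hf
    obtain ⟨z, hz, h₁, h₂⟩ := hM0 f hf
    exact ⟨z, hz, h₂, h₁⟩

end Terminal

/-! ## The pair read, splitting off and setting the privates -/

/-- **The two-variable read**: `gval {a, b} ∅ x = x_a ⊕ x_b` for `a ≠ b`. -/
theorem gval_pair (I : LocalMap 4 n m) {a b : Fin n} (hab : a ≠ b) (x : Fin n → Bool) :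
    gval I {a, b} ∅ x = xor (x a) (x b) := by
  apply bit_injective
  rw [bit_gval, sum_pair hab, sum_empty, add_zero, bit_xor]

/-- Splitting the two privates of `c` off the linear part of a G-constraint whose monomials avoid them:
`gval C G = gval (C ∖ {p, q}) G + [p ∈ C]·x_p + [q ∈ C]·x_q`. -/
theorem bit_gval_split (I : LocalMap 4 n m) {p q : Fin n} (hpq : p ≠ q) (C : Finset (Fin n)) (G : Finset (Fin m)) (x : Fin n → Bool) :
    bit (gval I C G x) = bit (gval I ((C.erase p).erase q) G x) + (if p ∈ C then bit (x p) else 0) + (if q ∈ C then bit (x q) else 0) := by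
  classical
  rw [bit_gval, bit_gval]
  have hsplit : ∑ w ∈ C, bit (x w) = ∑ w ∈ (C.erase p).erase q, bit (x w) + (if p ∈ C then bit (x p) else 0) +
      (if q ∈ C then bit (x q) else 0) := by
    by_cases hp : p ∈ C
    · rw [if_pos hp, ← sum_erase_add _ _ hp]
      by_cases hq : q ∈ C
      · rw [if_pos hq, ← sum_erase_add _ _ (mem_erase.2 ⟨hpq.symm, hq⟩)]; ring
      · rw [if_neg hq, erase_eq_of_notMem (fun h => hq (mem_of_mem_erase h))]; ring
    · rw [if_neg hp, erase_eq_of_notMem hp]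
      by_cases hq : q ∈ C
      · rw [if_pos hq, ← sum_erase_add _ _ hq]; ring
      · rw [if_neg hq, erase_eq_of_notMem hq]; ring
  rw [hsplit]
  ring

/-- `if P then bit u else 0 = bit (P ∧ u)`. -/
private theorem ite_bit_eq (P : Prop) [Decidable P] (u : Bool) : (if P then bit u else 0) = bit (decide P && u) := by
  by_cases h : P <;> simp [h, bit]

/-- The same split in Booleans: `gval C G = gval (C ∖ {p, q}) G ⊕ [p ∈ C]·x_p ⊕ [q ∈ C]·x_q`. -/
theorem gval_eq_split (I : LocalMap 4 n m) {p q : Fin n} (hpq : p ≠ q) (C : Finset (Fin n)) (G : Finset (Fin m)) (x : Fin n → Bool) :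
    gval I C G x = xor (xor (gval I ((C.erase p).erase q) G x) (decide (p ∈ C) && x p)) (decide (q ∈ C) && x q) := by
  apply bit_injective
  rw [bit_gval_split I hpq C G x, bit_xor, bit_xor, ite_bit_eq, ite_bit_eq]

/-- A G-constraint without `p, q` in its linear part and with monomials avoiding `p, q` does not see `p, q`. -/
theorem gval_update_pq (I : LocalMap 4 n m) {p q : Fin n} {C : Finset (Fin n)} {G : Finset (Fin m)} (hp : p ∉ C) (hq : q ∉ C)
    (hG : ∀ g ∈ G, (I.vars g 2 ≠ p ∧ I.vars g 3 ≠ p) ∧ (I.vars g 2 ≠ q ∧ I.vars g 3 ≠ q)) (x : Fin n → Bool) (π κ : Bool) :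
    gval I C G (Function.update (Function.update x p π) q κ) = gval I C G x := by
  apply bit_injective
  rw [bit_gval_update_lin I C _ (fun g hg => (hG g hg).2), if_neg hq, add_zero,
    bit_gval_update_lin I C _ (fun g hg => (hG g hg).1), if_neg hp, add_zero]

section Privates

variable {I : LocalMap 4 n m} {J₀ : Finset (Fin m)} {c : Fin m} {y : Fin m → Bool}

/-- **Setting the privates.**  At a solution of `J₀ ∖ c` with `x_a ⊕ x_b ⊕ (π ∧ κ) = y_c`, the point `x[p := π, q := κ]` solves the whole core
(`p = vars c 2`, `q = vars c 3` private, `a = vars c 0`, `b = vars c 1`). -/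
theorem solves_set_privates (hI : I.IsPure xorAndPred) (hc : c ∈ J₀) (hch : IsChord I J₀ c) {x : Fin n → Bool}
    (hx : ∀ j ∈ J₀.erase c, I.eval x j = y j) (π κ : Bool)
    (hab : xor (xor (x (I.vars c 0)) (x (I.vars c 1))) (π && κ) = y c) :
    ∀ j ∈ J₀, I.eval (Function.update (Function.update x (I.vars c 2) π) (I.vars c 3) κ) j = y j := by
  have hpp : (I.vars c 2 = I.vars c 2 ∧ I.vars c 3 = I.vars c 3) ∨ (I.vars c 2 = I.vars c 3 ∧ I.vars c 3 = I.vars c 2) := Or.inl ⟨rfl, rfl⟩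
  obtain ⟨-, h0p, h0q, h1p, h1q⟩ := slots_ne hI hpp
  have h23 : I.vars c 2 ≠ I.vars c 3 := fun h => absurd (hI.2 c h) (by decide)
  intro j hj
  by_cases hjc : j = c
  · subst hjc
    apply bit_injective
    rw [bit_eval_e hI hpp, Function.update_self, Function.update_of_ne h23, Function.update_self, Function.update_of_ne h0q,
      Function.update_of_ne h0p, Function.update_of_ne h1q, Function.update_of_ne h1p, ← hab, bit_xor, bit_xor, bit_and]
  · rw [eval_update_of_private hc hj hjc hch.2 (vars_mem_varSet I c 3) _ κ,
      eval_update_of_private hc hj hjc hch.1 (vars_mem_varSet I c 2) x π]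
    exact hx j (mem_erase.2 ⟨hjc, hj⟩)

/-- At a point satisfying the equation of `c`: `x_a ⊕ x_b = y_c ⊕ (x_p ∧ x_q)`. -/
theorem xor_eq_of_eval (hI : I.IsPure xorAndPred) {x : Fin n → Bool} (hxc : I.eval x c = y c) :
    xor (x (I.vars c 0)) (x (I.vars c 1)) = xor (y c) (x (I.vars c 2) && x (I.vars c 3)) := by
  have hpp : (I.vars c 2 = I.vars c 2 ∧ I.vars c 3 = I.vars c 3) ∨ (I.vars c 2 = I.vars c 3 ∧ I.vars c 3 = I.vars c 2) := Or.inl ⟨rfl, rfl⟩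
  have h := bit_eval_e hI hpp x
  rw [hxc] at h
  apply bit_injective
  rw [bit_xor, bit_xor, bit_and]
  have e : ∀ Y A B P : ZMod 2, Y = A + B + P → A + B = Y + P := by decide
  exact e _ _ _ _ h

/-- **An XOR-closed set is never a single chord**: with `c ∈ J₀` XOR-closed there is another output `f ∈ J₀`, `f ≠ c`
(the XOR variable `vars c 0` is read by at least two outputs of `J₀`). -/
theorem exists_ne_of_xorClosed (hX : XorClosed I J₀) (hc : c ∈ J₀) : ∃ f ∈ J₀, f ≠ c := by
  classical
  by_contra h
  push Not at h
  have hJ : J₀ = {c} := eq_singleton_iff_unique_mem.2 ⟨hc, h⟩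
  have hdeg : degIn I J₀ (I.vars c 0) = 1 := by
    unfold PstarSAClosure.degIn
    rw [hJ, filter_singleton, if_pos (vars_mem_varSet I c 0), card_singleton]
  exact hX c hc 0 (by decide) ((mem_bdry_iff I J₀ _).2 hdeg)

end Privates

end Summit.PneNP.PneNP.Theorems.PstarChordReadsMirror
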